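import Literature.MathematicalPhysics.QuantumFieldTheory.Balaban1983to89.B8Eq146AExpansion

/-!
# `Balaban1983to89.B8Eq151V2Divergence` — B8 Sect. C (1.50)–(1.54): the bracket `{…}` of `V₂` at `p_{μν}(x)`,
# `D^{η*}_{U₀}V₂ = −2Σ_ν D*_ν[A_μ, A_ν] + O₁(48d|A||∇^η_{U₀}A|)`, the product rule (1.52), `½η²D^{η*}_{U₀}V₂ =
# O₁(32d|A||∇^η_{U₀}A|η²)` and the gathering (1.54) with the printed constants `36d`, `50d`, `10d`

CITATION HEADER (lean-in-tree rule 2026-08-18).  Kernel certificate written by the B08 owner lineage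
(`b2b-balaban-b08`, generation 25) of the audit cell `pub-balaban` for

* **B8** = T. Bałaban, *Spaces of regular gauge field configurations on a lattice and gauge fixing conditions*,
  Commun. Math. Phys. **99** (1985) 75–102 [cite key `Balaban1985RegularSpaces`; printed page = PDF page + 74;
  renders READ AS IMAGES by this unit: `1985-cmp99-regular-spaces-gauge-fixing-p010/p011/p012-x4.png` = printed
  pp. 84, 85, 86],
* with the adjoint derivative and the orientation convention of **B9** = T. Bałaban, *Propagators for lattice
  gauge theories in a background field*, Commun. Math. Phys. **99** (1985) 389–434 = reference [4] of B8 [cite key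
  `Balaban1985BackgroundPropagators`; printed page = PDF page + 388; renders READ AS IMAGES:
  `1985-cmp99-background-propagators-p003/p004-x4.png` = printed pp. 391, 392, (3.3)–(3.5), (3.8)–(3.9)],

on top of the parent module `B8Eq146AExpansion` (the four variables `X1 … X4` of (1.49), `lin = Σᵢxᵢ`, `quad`,
`V2` = (1.49) verbatim, `adR X Y = [X, Y]`, `plaqCovDeriv` = B9 (3.4), `expCfg B = e^{B}`, `iEta η A = iηA`,
`main146`, and the kernel theorems `eq146`/`eq146_printed`, `eq148`/`eq148_printed`) and its parents
`B8Eq143PlaqExpansion` (`pdiv` = (1.2) for a general plaquette function, `covPlaqF` = `∂_{U₀}U₁`, `eq144` /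
`eq144_printed` = (1.44)) and `B8Ineq132` (`covDeriv` = the backward derivative of (1.1) = B9 (3.8), `covDerivFwd` =
the forward derivative (1.1) = B9 (3.3), `covDiv` = (1.2), `conjR` = `R(U)X = UXU⁻¹`).  Nothing in this module is
cited FROM the manuscript as a fact: the displays (1.50)–(1.54) enter only as the STATEMENTS of kernel-proved
theorems over the parent modules' definitions — the ABSOLUTE RULE of the cell (no internally-minted statement enters
as a cited fact; the manuscript under audit is not citable for its own steps).  Both papers are UNDER ADJUDICATION
by the cell; nothing of them is asserted here.

## The printed texts (verbatim, from the renders read as images; «…» = print, letter for letter)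

* B8 p. 85 [PDF 11], after the display (1.49) (typed verbatim in the parent module as `V2` /
  `V2_eq_sq_add_commutators`): «This equality holds for arbitrary A in the complexified Lie algebra, but if A is
  Hermitian, then the first expression above is a real part of V₂, and the second is an imaginary part of V₂,
  multiplied by i. Let p = p_{μν}(x), then the expression in {…} can be written as
  {…} = 2[A_μ(x), A_ν(x)] + 2η[A_μ(x), (D_μA_ν)(x)] + 2η[(D_νA_μ)(x), A_ν(x)] − η[A_μ(x), (D_νA_μ)(x)]
        − η[(D_μA_ν)(x), A_ν(x)] − η²[(D_μA_ν)(x), (D_νA_μ)(x)], (1.50)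
  where D_μ denotes the derivative D^η_{U₀,μ}. From these equalities we see that all the terms in V₂, except the
  first term on the right-hand side above, have some powers of η. If we apply D^{η*}_{U₀} to V₂, we use these
  factors to cancel η⁻¹ and to replace D^{η*}_{U₀} by D^{1*}_{U₀}, which is a very simple bounded operator. Thus
  D^{η*}_{U₀}V₂(U₀, A) = −2 Σ_{ν=1}^{d} D*_ν[A_μ, A_ν] + O₁(48d|A| |∇^η_{U₀}A|). (1.51)
  Further
  (D*_ν[A_μ, A_ν])(x) = η[(D*_νA_μ)(x), (D*_νA_ν)(x)] + [(D*_νA_μ)(x), A_ν(x)] + [A_μ(x), (D*_νA_ν)(x)], (1.52)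
  hence, taking into account the identity (D*_μA)(x) = −R(U₀(x − ηe_μ, x))(D_μA)(x − ηe_μ), we get
  ½η²D^{η*}_{U₀}V₂(U₀, A) = O₁(32d|A| |∇^η_{U₀}A|η²) = O₁(32dα₂(Lʲη)⁻¹|∇^η_{U₀}A|η²). (1.53)
  Gathering together the equalities and the estimates obtained until now we get
  D^{η*}_{U₁U₀}∂U₁U₀ = D^{η*}_{U₀}∂U₀ + iη²D^{η*}_{U₀}D^η_{U₀}A + O₁(36dα₂(Lʲη)⁻¹|∇^η_{U₀}A|η²)
        + O₁(50dα₂³(Lʲη)⁻³η²) + O₁(10dα₀α₂(Lʲη)⁻³η²) on Ω_j. (1.54)»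
* B8 p. 86 [PDF 12], first lines: «This is the basic estimate. It will be applied in several different situations
  in the future. Let us recall that it was derived under the assumption (0.1) for U₀ and (1.41) for U₁.» ((1.41),
  p. 83 [PDF 9]: «U₁ = e^{iηA}, |A| < α₂(Lʲη)⁻¹ on Ω_j, (1.41)»; (0.1), p. 75 [PDF 1]: «|U(∂p) − 1| < α₀η², η = L⁻ᵏ
  (0.1)», entering (1.44) on `Ω_j` in the scaled units `p = α₀η²(Lʲη)⁻²` of the parent `B8Eq143PlaqExpansion`.)
* B9 p. 391 [PDF 3]: «(D^η_{U₀,μ}A)(x) = (D^η_{U₀}A)(x, x + ηe_μ), μ = 1, …, d. (3.3)» and (3.4)–(3.5) (quoted in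
  the parent module: `(D^η_{U₀}A)(p_{μν}(x)) = (D^η_{U₀,μ}A_ν)(x) − (D^η_{U₀,ν}A_μ)(x)`, `A(x, x′) = −A(x′, x)`).
* B9 p. 392 [PDF 4]: «for derivative D acting on functions defined at points of the lattice, the adjoint operator
  D* is acting on functions A defined at bonds of the lattice by the formulas
  (D*A)(x) = Σ_{μ=1}^{d} η⁻¹(R(U(x, x − ηe_μ))A(x − ηe_μ, x) − A(x, x + ηe_μ)) = Σ_{μ=1}^{d}(D*_μA_μ)(x)
  = Σ_{μ=1}^{d}(DA_μ)(x, x − ηe_μ). (3.8)» and «(D*F)(x, x + ηe_μ) = (D*F)_μ(x) = Σ_{ν<μ}(D*_νF_{νμ})(x) −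
  Σ_{ν>μ}(D*_νF_{μν})(x) = Σ_{ν=1}^{d}(D*_νF_{νμ})(x), (3.9) where F_{μν}(x) = F(p_{μν}(x)), and in the last equality
  above we have assumed that F_{μν}(x) = −F_{νμ}(x).»

## Dictionary (the `ℤ^d` model of the parent modules; additions of this module in **bold**)

Sites `Site d = Fin d → ℤ` (lattice spacing = the explicit `η > 0`), bond fields `B : Site d → Fin d → 𝔸` over a
normed `ℂ`-algebra `𝔸` with `‖1‖ = 1` (complete where `e^{B}` occurs), `B y κ = B(y, y + e_κ)`; `U₀` is `U1`-valued
(`‖u‖ ≤ 1 ∧ ‖u⁻¹‖ ≤ 1` ⊇ `U(N)`).  As in the parent module every identity / estimate is typed for a GENERAL exponent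
field `B` («arbitrary A in the complexified Lie algebra») and then specialised to print's letters.
* `D_μ = D^η_{U₀,μ}` (forward, (1.1) first line = B9 (3.3)) ↦ `covDerivFwd η U₀ μ F x = η⁻¹(R(U₀(x, x + e_μ))F(x + e_μ)
  − F(x))` applied to the site function `F = B(·)_ν` ↦ `fun y => B y ν`;  `D*_ν = D^{η*}_{U₀,ν}` (backward, (1.1)
  second line = B9 (3.8)) ↦ `covDeriv η U₀ ν F x = η⁻¹(R(U₀(x, x − e_ν))F(x − e_ν) − F(x))` with `R(U₀(x, x − e_ν)) =
  R(U₀(x − e_ν, x)⁻¹)` ((3.5)); `D^{η*}_{U₀}` on plaquette functions ((1.2) = B9 (3.9)) ↦ `pdiv η U₀ F μ x`;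
* the bracket `{…}` of (1.49)/(1.50) ↦ **`brk U₀ B μ ν x`** `= [x₁,x₂] + [x₁,x₃] + [x₁,x₄] + [x₂,x₃] + [x₂,x₄] +
  [x₃,x₄]`;  its `η`-free term «the first term on the right-hand side above» `2[A_μ(x), A_ν(x)]` as a plaquette
  function ↦ **`brk0 B μ ν x = 2[B_μ(x), B_ν(x)]`**;
* `|A|` ↦ a uniform bound `‖B y κ‖ ≤ a` (print: `|A| < α₂(Lʲη)⁻¹`, (1.41));  `|∇^η_{U₀}A|` ↦ a uniform bound on the
  covariant gradient, `‖(D^η_{U₀,κ}B_τ)(y)‖ ≤ G` for all `y, κ, τ` ↦ `hG : ∀ y κ τ, ‖covDerivFwd η U₀ κ (fun z ↦ B z τ) y‖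
  ≤ G` (by the transport identity the backward derivatives obey the same bound, `norm_covDeriv_eq`);
* print's letters: `B = iηA` ↦ `iEta η A`, `U₁ = e^{iηA}` ↦ `expCfg (iEta η A)`, `r = (Lʲη)⁻¹` ↦ `((L : ℝ) ^ j * η)⁻¹`,
  `iη²D^{η*}_{U₀}D^η_{U₀}A` ↦ `(iη²) • pdiv η U₀ (plaqCovDeriv η U₀ A) μ x` (= `pdiv η U₀ (lin U₀ (iηA))`,
  `lin_quad_iEta` of the parent), `½η²D^{η*}_{U₀}V₂(U₀, A)` ↦ `(η²/2) • pdiv η U₀ (V2 U₀ A) μ x`.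

## What is certified (kernel, `sorry`-free; axioms `propext` / `Classical.choice` / `Quot.sound`)

§1 [folklore] `R(u)(XY) = R(u)X·R(u)Y`, `R(u)[X, Y] = [R(u)X, R(u)Y]`; `x₂ = B_ν(x) + η(D_μB_ν)(x)`, `x₃ = −(B_μ(x) +
η(D_νB_μ)(x))` (`X2_eq`, `X3_eq`); **(1.50)** EXACTLY (`eq150`: `{…} = 2[B_μ, B_ν] + 2η[B_μ, D_μB_ν] + 2η[D_νB_μ, B_ν]
− η[B_μ, D_νB_μ] − η[D_μB_ν, B_ν] − η²[D_μB_ν, D_νB_μ]` at `x`, from the tree's ring identity `B8.commutators_150`),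
and `V₂ = (Σᵢxᵢ)² + {…}` (`V2_eq_sq_add_brk`, parent).  §2 **(1.52)** EXACTLY for arbitrary site functions `F, H`
(`eq152`: `D*_ν[F, H] = η[D*_νF, D*_νH] + [D*_νF, H] + [F, D*_νH]`), and THE TRANSPORT IDENTITY before (1.53) in the
form the definitions force, `(D*_νF)(x) = −R(U₀(x, x − e_ν))(D_νF)(x − e_ν)` (`covDeriv_eq_neg_conjR_covDerivFwd`;
`R(U₀(x, x − e_ν)) = R(U₀(x − e_ν, x))⁻¹` — see HONEST SCOPE (ii)), hence `|D*_νF(x)| = |D_νF(x − e_ν)|` for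
`U1`-valued `U₀` (`norm_covDeriv_eq`, §3); THE MAIN TERM: `D^{η*}_{U₀}(2[B_μ, B_ν])_μ(x) = −2Σ_{ν≠μ}(D*_ν[B_μ, B_ν])(x)
= −2Σ_{ν=1}^{d}(D*_ν[B_μ, B_ν])(x)` (`pdiv_brk0`, `pdiv_brk0_univ`: antisymmetry `[B_ν, B_μ] = −[B_μ, B_ν]` for
`ν < μ`, `[B_μ, B_μ] = 0`).  §3 THE REST: `|V₂(p_{μν}(x)) − 2[B_μ(x), B_ν(x)]| ≤ 24η·a·G` per plaquette
(`norm_V2_sub_brk0_le`: `|Σxᵢ|·|Σxᵢ| ≤ 4a·2ηG` and the five `η`-terms of (1.50), `4 + 4 + 2 + 2 + 4`, using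
`|η(D_μB_ν)(x)| ≤ 2a`), so **(1.51)**: `|D^{η*}_{U₀}V₂,_μ(x) + 2Σ_{ν≠μ}D*_ν[B_μ, B_ν](x)| ≤ 48(d − 1)·a·G` (`eq151`; the
`η⁻¹` of `D^{η*}` cancels the `η` — «we use these factors to cancel η⁻¹»); **(1.52) ⇒** `|D*_ν[B_μ, B_ν](x)| ≤ 8aG`
(`norm_covDeriv_adR_le`), `|D^{η*}_{U₀}V₂,_μ(x)| ≤ 64(d − 1)aG` (`eq153`), `|D^{η*}_{U₀}(quad)_μ(x)| ≤ 32(d − 1)aG`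
(`eq153_quad`, `quad = ½V₂`).  §4 PRINT'S LETTERS (`B := A`, `|A| ≤ α`, `|∇^η_{U₀}A| ≤ G`): **(1.51) with `48d`**
(`eq151_printed`: `|D^{η*}_{U₀}V₂(U₀, A) − (−2Σ_{ν=1}^{d}D*_ν[A_μ, A_ν])| ≤ 48d|A||∇A|`), **(1.53) with `32d`**
(`eq153_printed`: `|½η²D^{η*}_{U₀}V₂(U₀, A)| ≤ 32d·α·G·η²`; with `α = α₂(Lʲη)⁻¹` this is print's second form).
§5 **(1.54)**: `|main146| ≤ 4(d − 1)aG` (`norm_main146_le`: `|ad_b(Σxᵢ)| ≤ 2a·2ηG`, `d − 1` directions); the SHARP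
gathering for a general exponent field (`eq154`): for `U1`-valued `U₀` and `U₁ = e^{B}`, `|B| ≤ a`, `|∇B| ≤ G`,
`|U₁ − 1| ≤ u`, `|U₀(∂p) − 1| ≤ p`,
`|D^{η*}_{U₁U₀}∂(U₁U₀)_μ(x) − D^{η*}_{U₀}∂U₀,_μ(x) − D^{η*}_{U₀}(Σᵢxᵢ)_μ(x)| ≤ 36(d − 1)aG + (d − 1)η⁻¹Φ(a) + 2(d − 1)η⁻¹ρ₃(4a)
+ 10(d − 1)η⁻¹up` (= `eq144 + eq146 + eq148 + eq153_quad + norm_main146_le`, `36 = 32 + 4`); and **(1.54) WITH THE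
PRINTED CONSTANTS** (`eq154_printed`): for `U₁ = e^{iηA}` `U1`-valued with `|U₁ − 1| ≤ α₂(Lʲη)⁻¹η`, `|A| ≤ α₂(Lʲη)⁻¹`,
`|∇^η_{U₀}A| ≤ G`, `|U₀(∂p) − 1| ≤ α₀η²(Lʲη)⁻²`, `α₀, α₂ ≥ 0`, `η > 0`, and the smallness `16α₂(Lʲη)⁻¹η ≤ 1 ∧
5α₂(Lʲη)⁻¹η(d − 1) ≤ 4`:
`|D^{η*}_{U₁U₀}∂(U₁U₀) − D^{η*}_{U₀}∂U₀ − iη²D^{η*}_{U₀}D^η_{U₀}A| ≤ 36dα₂(Lʲη)⁻¹Gη² + 50dα₂³(Lʲη)⁻³η² + 10dα₀α₂(Lʲη)⁻³η²`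
at every bond (`10d` = `eq144_printed`, `50d ≥ 28d + (4³/3)d` = `eq146_printed` + `eq148_printed`, `36d = 32d + 4d`).

## HONEST SCOPE — what is NOT claimed

(i) As in the parent: `U₀` is `U1`-valued; `B` is arbitrary; the sharp forms (`eq151`, `eq153`, `eq154`) count the
`d − 1` directions `ν ≠ μ` where print writes `d`, and the `_printed` corollaries pass to `d` by `d − 1 ≤ d` — so
print's `48d`, `32d`, `36d`, `10d` are certified EXACTLY (indeed with `d − 1`), while `50d` is certified only under
OUR explicit smallness `16a ≤ 1 ∧ 5a(d − 1) ≤ 4`, `a = ηα₂(Lʲη)⁻¹` (inherited from `eq146_printed` / `eq148_printed`;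
print: (1.41) and «α₀ + α₁ sufficiently small»); the all-`d` statement is the sharp `eq154`.  (ii) THE TRANSPORT
IDENTITY: print (p. 85) writes `(D*_μA)(x) = −R(U₀(x − ηe_μ, x))(D_μA)(x − ηe_μ)`; with `D*_μ` as printed in B9 (3.8)
(`R(U(x, x − ηe_μ))`, the tree's `covDeriv`) and `D_μ` = B9 (3.3) (the tree's `covDerivFwd`) the kernel identity
carries `R(U₀(x, x − ηe_μ)) = R(U₀(x − ηe_μ, x))⁻¹`, i.e. the transport along the bond read from `x − ηe_μ` to `x`;
print's symbol is recorded as an orientation slip / notational variant (cell DIVERGENCE D-b08-g25.1) — immaterial for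
(1.53), where only `|R(·)X| = |X|` is used.  (iii) «to replace D^{η*}_{U₀} by D^{1*}_{U₀}, which is a very simple
bounded operator»: we do not form `D^{1*}_{U₀}`; the `η`-factors of (1.50) are cancelled against the `η⁻¹` of (1.1)
inside the norm estimate (`norm_covDeriv_le` of the parent: `|D*_νG(x)| ≤ η⁻¹(|G(x − e_ν)| + |G(x)|)`), which is the
same arithmetic.  (iv) In `eq154_printed` the configuration `U₁ = e^{iηA}` is ASSUMED `U1`-valued and `|U₁ − 1| ≤
α₂(Lʲη)⁻¹η` is ASSUMED (print's (1.41) for Hermitian `A` in `U(N)`, where `|e^{iηA} − 1| ≤ η|A|`); the sharp `eq154`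
instead takes `|U₁ − 1| ≤ u` as data (`u = e^{a} − 1` always works: `norm_expCfg_sub_one_le`).  (v) All bounds are
GLOBAL (every bond / plaquette) where print localises to `Ω_j`; print's strict `<` are certified as `≤`.  (vi) NOT
typed here: (1.55) (p. 86: the bound on `J = D^{η*}_{U₀}D^η_{U₀}A` obtained from (1.54) with (1.40), (1.42)) and the
sequel (1.56)–(1.61) (the translation `A = A₁ + H(U₀)B₁`, the operator `G(U₀)` of [4], the bootstrap «B₀36dα₂ ≦
1/2»), nor the Hermitian real/imaginary-part remark after (1.49).  (vii) Nothing here is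
progress on the summit `Summit.QuantumFields` — the value is a kernel section certificate for B8 (1.50)–(1.54).
-/

noncomputable section

open scoped BigOperators
open NormedSpace Finset

namespace Literature.MathematicalPhysics.QuantumFieldTheory.Balaban1983to89.B8Eq151V2Divergence

open B7Prop1Explicit
open B7Eq78Linearization (conjR conjR_apply conjR_one conjR_add conjR_sub conjR_smul conjR_smul_real)
open B8Lemma1NonAbelian (mulCfg)
open B8Ineq132 (plaqF covDeriv covDerivFwd covDiv conjR_conjR one_conjR conjR_sum conjR_units norm_conjR_le
  norm_conjR)
open B8Eq143PlaqExpansion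
open B8Eq146AExpansion

-- `Site` alone would resolve to the torus sites of `Setup.lean`; re-export the `ℤ^d` sites of `B7Prop1Explicit`.
export B7Prop1Explicit (Site)

variable {d : ℕ}

/-! ## §1 Algebra: `R(u)` is multiplicative, the bracket `{…}` of (1.49), and **(1.50)** -/
section Algebra

variable {𝔸 : Type*} [NormedRing 𝔸]

/-- `R(u)(XY) = (R(u)X)(R(u)Y)` — `R(u)` is an algebra automorphism. [folklore] -/
theorem conjR_mul (u : 𝔸ˣ) (X Y : 𝔸) : conjR u (X * Y) = conjR u X * conjR u Y := by
  simp only [conjR_apply, mul_assoc, Units.inv_mul_cancel_left]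

/-- `R(u)[X, Y] = [R(u)X, R(u)Y]`. [folklore] -/
theorem conjR_adR (u : 𝔸ˣ) (X Y : 𝔸) : conjR u (adR X Y) = adR (conjR u X) (conjR u Y) := by
  simp only [adR, conjR_sub, conjR_mul]

/-- `[X, X] = 0` (the `ν = μ` summand of (1.51) vanishes). [folklore] -/
theorem adR_self (X : 𝔸) : adR X X = 0 := sub_self _

/-- `[Y, X] = −[X, Y]` («we have assumed that F_{μν}(x) = −F_{νμ}(x)», (3.9) of [B9]). [folklore] -/
theorem adR_swap (X Y : 𝔸) : adR Y X = -adR X Y := by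
  simp only [adR, neg_sub]

/-- `|2Z| ≤ 2|Z|`. [folklore] -/
theorem norm_two_mul_le (Z : 𝔸) : ‖2 * Z‖ ≤ 2 * ‖Z‖ := by
  rw [two_mul, two_mul]
  exact norm_add_le _ _

/-- `|A + B + C − D − E − F| ≤ |A| + |B| + |C| + |D| + |E| + |F|`. [folklore] -/
theorem norm_six_le (A B C D E F : 𝔸) :
    ‖A + B + C - D - E - F‖ ≤ ‖A‖ + ‖B‖ + ‖C‖ + ‖D‖ + ‖E‖ + ‖F‖ := by
  have h1 := norm_sub_le (A + B + C - D - E) F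
  have h2 := norm_sub_le (A + B + C - D) E
  have h3 := norm_sub_le (A + B + C) D
  have h4 : ‖A + B + C‖ ≤ ‖A‖ + ‖B‖ + ‖C‖ := norm_add₃_le
  linarith

/-- `|[X, Y]| ≤ 2st` for `|X| ≤ s`, `|Y| ≤ t`. [folklore] -/
theorem norm_adR_le_of_le {X Y : 𝔸} {s t : ℝ} (hX : ‖X‖ ≤ s) (hY : ‖Y‖ ≤ t) : ‖adR X Y‖ ≤ 2 * s * t :=
  (norm_adR_le X Y).trans (mul_le_mul (mul_le_mul_of_nonneg_left hX zero_le_two) hY (norm_nonneg _)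
    (mul_nonneg zero_le_two ((norm_nonneg _).trans hX)))

/-- THE BRACKET `{…}` OF (1.49): `[x₁, x₂] + [x₁, x₃] + [x₁, x₄] + [x₂, x₃] + [x₂, x₄] + [x₃, x₄]` =
`{[A(x,y), R(U₀(x,y))A(y,z)] + [A(x,y), R(U₀(x,w))A(z,w)] + [A(x,y), A(w,x)] + [R(U₀(x,y))A(y,z), R(U₀(x,w))A(z,w)]
+ [R(U₀(x,y))A(y,z), A(w,x)] + [R(U₀(x,w))A(z,w), A(w,x)]}` for the exponent field `B`.
[cite: Balaban1985RegularSpaces, (1.49) p.85] -/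
def brk (U₀ : Site d → Fin d → 𝔸ˣ) (B : Site d → Fin d → 𝔸) (μ ν : Fin d) (x : Site d) : 𝔸 :=
  adR (X1 B μ x) (X2 U₀ B μ ν x) + adR (X1 B μ x) (X3 U₀ B μ ν x) + adR (X1 B μ x) (X4 B ν x)
    + adR (X2 U₀ B μ ν x) (X3 U₀ B μ ν x) + adR (X2 U₀ B μ ν x) (X4 B ν x) + adR (X3 U₀ B μ ν x) (X4 B ν x)

/-- (1.49), second member: `V₂ = (x₁ + x₂ + x₃ + x₄)² + {…}` (the parent's `V2_eq_sq_add_commutators`).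
[cite: Balaban1985RegularSpaces, (1.49) p.85] -/
theorem V2_eq_sq_add_brk (U₀ : Site d → Fin d → 𝔸ˣ) (B : Site d → Fin d → 𝔸) (μ ν : Fin d) (x : Site d) :
    V2 U₀ B μ ν x = lin U₀ B μ ν x * lin U₀ B μ ν x + brk U₀ B μ ν x :=
  V2_eq_sq_add_commutators U₀ B μ ν x

/-- «the first term on the right-hand side above»: the `η`-free term `2[A_μ(x), A_ν(x)]` of (1.50), as a plaquette
function `(μ, ν, x) ↦ 2[B_μ(x), B_ν(x)]`. [cite: Balaban1985RegularSpaces, (1.50)-(1.51) p.85] -/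
def brk0 (B : Site d → Fin d → 𝔸) : Fin d → Fin d → Site d → 𝔸 := fun μ ν x => 2 * adR (B x μ) (B x ν)

/-- Unfolding `brk0`. [folklore] -/
theorem brk0_apply (B : Site d → Fin d → 𝔸) (μ ν : Fin d) (x : Site d) :
    brk0 B μ ν x = 2 * adR (B x μ) (B x ν) := rfl

variable [NormedAlgebra ℂ 𝔸]

/-- `η(D_μF)(x) = R(U(x, x + e_μ))F(x + e_μ) − F(x)`, `η ≠ 0`. [cite: Balaban1985RegularSpaces, (1.1) p.76] -/
theorem eta_smul_covDerivFwd {η : ℝ} (hη : η ≠ 0) (V : Site d → Fin d → 𝔸ˣ) (κ : Fin d) (F : Site d → 𝔸)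
    (y : Site d) : η • covDerivFwd η V κ F y = conjR (V y κ) (F (y + e κ)) - F y := by
  rw [covDerivFwd, smul_smul, mul_inv_cancel₀ hη, one_smul]

/-- `η(D*_νF)(x) = R(U(x, x − e_ν))F(x − e_ν) − F(x)`, `η ≠ 0`. [cite: Balaban1985RegularSpaces, (1.1) p.76] -/
theorem eta_smul_covDeriv {η : ℝ} (hη : η ≠ 0) (V : Site d → Fin d → 𝔸ˣ) (ν : Fin d) (F : Site d → 𝔸)
    (x : Site d) : η • covDeriv η V ν F x = conjR (V (x - e ν) ν)⁻¹ (F (x - e ν)) - F x := by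
  rw [covDeriv, smul_smul, mul_inv_cancel₀ hη, one_smul]

/-- `x₂ = R(U₀(x, x + ηe_μ))A_ν(x + ηe_μ) = A_ν(x) + η(D_μA_ν)(x)` (the dictionary of `B8.commutators_150`), `η ≠ 0`.
[cite: Balaban1985RegularSpaces, (1.50) p.85] -/
theorem X2_eq {η : ℝ} (hη : η ≠ 0) (U₀ : Site d → Fin d → 𝔸ˣ) (B : Site d → Fin d → 𝔸) (μ ν : Fin d)
    (x : Site d) : X2 U₀ B μ ν x = B x ν + η • covDerivFwd η U₀ μ (fun y => B y ν) x := by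
  rw [eta_smul_covDerivFwd hη, X2]
  abel

/-- `x₃ = −R(U₀(x, x + ηe_ν))A_μ(x + ηe_ν) = −(A_μ(x) + η(D_νA_μ)(x))`, `η ≠ 0`. [cite: Balaban1985RegularSpaces, (1.50) p.85] -/
theorem X3_eq {η : ℝ} (hη : η ≠ 0) (U₀ : Site d → Fin d → 𝔸ˣ) (B : Site d → Fin d → 𝔸) (μ ν : Fin d)
    (x : Site d) : X3 U₀ B μ ν x = -(B x μ + η • covDerivFwd η U₀ ν (fun y => B y μ) x) := by
  rw [eta_smul_covDerivFwd hη, X3, conjR_neg]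
  abel

/-- `D_κ(cF) = c·D_κF` (complex scalar; parent: `covDeriv_smul` for the backward derivative). [folklore] -/
theorem covDerivFwd_smul (η : ℝ) (V : Site d → Fin d → 𝔸ˣ) (κ : Fin d) (c : ℂ) (F : Site d → 𝔸) (y : Site d) :
    covDerivFwd η V κ (c • F) y = c • covDerivFwd η V κ F y := by
  simp only [covDerivFwd, Pi.smul_apply, conjR_smul, ← smul_sub]
  exact smul_comm _ _ _

/-- `ad_{cX} = c·ad_X`, real scalar. [folklore] -/
theorem adR_smul_left_real (c : ℝ) (X Y : 𝔸) : adR (c • X) Y = c • adR X Y := by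
  rw [← Complex.coe_smul, adR_smul_left, Complex.coe_smul]

/-- **(1.50)** EXACTLY, for the exponent field `B` at the plaquette `p_{μν}(x)` (`η ≠ 0`):
`{…} = 2[B_μ(x), B_ν(x)] + 2η[B_μ(x), (D_μB_ν)(x)] + 2η[(D_νB_μ)(x), B_ν(x)] − η[B_μ(x), (D_νB_μ)(x)]
− η[(D_μB_ν)(x), B_ν(x)] − η²[(D_μB_ν)(x), (D_νB_μ)(x)]`, `D_μ = D^η_{U₀,μ}` — the tree's ring identity
`B8.commutators_150` on the dictionary `X2_eq` / `X3_eq`. [cite: Balaban1985RegularSpaces, (1.50) p.85] -/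
theorem eq150 {η : ℝ} (hη : η ≠ 0) (U₀ : Site d → Fin d → 𝔸ˣ) (B : Site d → Fin d → 𝔸) (μ ν : Fin d)
    (x : Site d) :
    brk U₀ B μ ν x =
      2 * adR (B x μ) (B x ν) + 2 * (η • adR (B x μ) (covDerivFwd η U₀ μ (fun y => B y ν) x))
        + 2 * (η • adR (covDerivFwd η U₀ ν (fun y => B y μ) x) (B x ν))
        - η • adR (B x μ) (covDerivFwd η U₀ ν (fun y => B y μ) x)
        - η • adR (covDerivFwd η U₀ μ (fun y => B y ν) x) (B x ν)
        - η ^ 2 • adR (covDerivFwd η U₀ μ (fun y => B y ν) x) (covDerivFwd η U₀ ν (fun y => B y μ) x) := by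
  rw [brk, X2_eq hη, X3_eq hη]
  simp only [X1, X4, adR, two_mul, mul_add, add_mul, mul_neg, neg_mul, neg_neg, smul_mul_assoc, mul_smul_comm,
    smul_add, smul_neg, smul_smul, sq, sub_eq_add_neg, neg_add]
  module

/-- `quad = ½V₂` as plaquette functions (parent: `V2_eq_two_smul_quad`). [cite: Balaban1985RegularSpaces, (1.47), (1.49) pp.84-85] -/
theorem quad_eq_half_V2 (U₀ : Site d → Fin d → 𝔸ˣ) (B : Site d → Fin d → 𝔸) :
    quad U₀ B = (2 : ℂ)⁻¹ • V2 U₀ B := by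
  funext κ τ y
  simp only [Pi.smul_apply, V2_eq_two_smul_quad, smul_smul, inv_mul_cancel₀ (two_ne_zero (α := ℂ)), one_smul]

/-! ## §2 **(1.52)** and the transport identity `(D*_νF)(x) = −R(U₀(x, x − ηe_ν))(D_νF)(x − ηe_ν)` -/

/-- **(1.52)** EXACTLY, for arbitrary site functions `F, H` (print: `F = A_μ`, `H = A_ν`), `η ≠ 0`:
`(D*_ν[F, H])(x) = η[(D*_νF)(x), (D*_νH)(x)] + [(D*_νF)(x), H(x)] + [F(x), (D*_νH)(x)]` — the backward Leibniz rule
of the conjugation-covariant difference quotient (`R(u)` multiplicative). [cite: Balaban1985RegularSpaces, (1.52) p.85] -/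
theorem eq152 {η : ℝ} (hη : η ≠ 0) (V : Site d → Fin d → 𝔸ˣ) (F H : Site d → 𝔸) (ν : Fin d) (x : Site d) :
    covDeriv η V ν (fun y => adR (F y) (H y)) x =
      η • adR (covDeriv η V ν F x) (covDeriv η V ν H x) + adR (covDeriv η V ν F x) (H x)
        + adR (F x) (covDeriv η V ν H x) := by
  have hF := eta_smul_covDeriv hη V ν F x
  have hH := eta_smul_covDeriv hη V ν H x
  generalize covDeriv η V ν F x = DF at hF ⊢
  generalize covDeriv η V ν H x = DH at hH ⊢
  rw [eq_sub_iff_add_eq] at hF hH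
  simp only [covDeriv, conjR_adR, ← hF, ← hH]
  have key : adR (η • DF + F x) (η • DH + H x) - adR (F x) (H x) =
      η • (η • adR DF DH + adR DF (H x) + adR (F x) DH) := by
    simp only [adR, mul_add, add_mul, smul_mul_assoc, mul_smul_comm, smul_add, smul_sub, smul_smul]
    module
  rw [key, smul_smul, inv_mul_cancel₀ hη, one_smul]

/-- THE TRANSPORT IDENTITY used before (1.53), in the form the definitions (1.1) / B9 (3.3), (3.8) force:
`(D*_νF)(x) = −R(U₀(x, x − ηe_ν))(D_νF)(x − ηe_ν)` with `R(U₀(x, x − ηe_ν)) = R(U₀(x − ηe_ν, x))⁻¹` (print writes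
`R(U₀(x − ηe_ν, x))`; see the module docstring, HONEST SCOPE (ii)).
[cite: Balaban1985RegularSpaces, p.85 (line after (1.52)); Balaban1985BackgroundPropagators, (3.3), (3.8) pp.391-392] -/
theorem covDeriv_eq_neg_conjR_covDerivFwd (η : ℝ) (V : Site d → Fin d → 𝔸ˣ) (ν : Fin d) (F : Site d → 𝔸)
    (x : Site d) : covDeriv η V ν F x = -conjR (V (x - e ν) ν)⁻¹ (covDerivFwd η V ν F (x - e ν)) := by
  simp only [covDeriv, covDerivFwd, sub_add_cancel, conjR_smul_real, conjR_sub, conjR_conjR, inv_mul_cancel,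
    one_conjR, ← smul_neg, neg_sub]

/-- `D*_ν(−F) = −D*_νF`. [folklore] -/
theorem covDeriv_neg (η : ℝ) (V : Site d → Fin d → 𝔸ˣ) (ν : Fin d) (F : Site d → 𝔸) (x : Site d) :
    covDeriv η V ν (fun y => -F y) x = -covDeriv η V ν F x := by
  simp only [covDeriv, conjR_neg, ← smul_neg, neg_sub, sub_neg_eq_add, neg_add_eq_sub]

/-- `D*_ν(2F) = 2D*_νF`. [folklore] -/
theorem covDeriv_two_mul (η : ℝ) (V : Site d → Fin d → 𝔸ˣ) (ν : Fin d) (F : Site d → 𝔸) (x : Site d) :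
    covDeriv η V ν (fun y => 2 * F y) x = 2 * covDeriv η V ν F x := by
  have h : (fun y => 2 * F y) = F + F := by
    funext y
    simp only [two_mul, Pi.add_apply]
  rw [h, covDeriv_add, two_mul]

/-- `D*_ν0 = 0`. [folklore] -/
theorem covDeriv_zero (η : ℝ) (V : Site d → Fin d → 𝔸ˣ) (ν : Fin d) (x : Site d) :
    covDeriv η V ν (fun _ => (0 : 𝔸)) x = 0 := by
  simp only [covDeriv, conjR_apply, mul_zero, zero_mul, sub_zero, smul_zero]

/-- THE MAIN TERM OF (1.51): `D^{η*}_{U₀}(2[B_μ, B_ν])_μ(x) = −2Σ_{ν≠μ}(D*_ν[B_μ, B_ν])(x)` — (1.2) with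
`F_{νμ} = −F_{μν}` for `ν < μ` («in the last equality above we have assumed that F_{μν}(x) = −F_{νμ}(x)», (3.9) of
[B9]). [cite: Balaban1985RegularSpaces, (1.51) p.85; Balaban1985BackgroundPropagators, (3.9) p.392] -/
theorem pdiv_brk0 (η : ℝ) (U₀ : Site d → Fin d → 𝔸ˣ) (B : Site d → Fin d → 𝔸) (μ : Fin d) (x : Site d) :
    pdiv η U₀ (brk0 B) μ x =
      -(2 * ∑ ν ∈ Finset.univ.erase μ, covDeriv η U₀ ν (fun y => adR (B y μ) (B y ν)) x) := by
  have h1 : ∀ ν, covDeriv η U₀ ν (brk0 B ν μ) x = -(2 * covDeriv η U₀ ν (fun y => adR (B y μ) (B y ν)) x) := by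
    intro ν
    have hf : brk0 B ν μ = fun y => -(2 * adR (B y μ) (B y ν)) := by
      funext y
      simp only [brk0, adR_swap (B y μ) (B y ν), mul_neg]
    rw [hf, covDeriv_neg, covDeriv_two_mul]
  have h2 : ∀ ν, covDeriv η U₀ ν (brk0 B μ ν) x = 2 * covDeriv η U₀ ν (fun y => adR (B y μ) (B y ν)) x := by
    intro ν
    have hf : brk0 B μ ν = fun y => 2 * adR (B y μ) (B y ν) := rfl
    rw [hf, covDeriv_two_mul]
  rw [pdiv, sum_erase_eq_Iio_add_Ioi μ]
  simp only [h1, h2, Finset.sum_neg_distrib, ← Finset.mul_sum, mul_add, neg_add, sub_eq_add_neg]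

/-- The same summed over all `ν = 1, …, d` as printed (`[B_μ, B_μ] = 0`): `D^{η*}_{U₀}(2[B_μ, B_ν])_μ(x) =
−2Σ_{ν=1}^{d}(D*_ν[B_μ, B_ν])(x)`. [cite: Balaban1985RegularSpaces, (1.51) p.85] -/
theorem pdiv_brk0_univ (η : ℝ) (U₀ : Site d → Fin d → 𝔸ˣ) (B : Site d → Fin d → 𝔸) (μ : Fin d) (x : Site d) :
    pdiv η U₀ (brk0 B) μ x = -(2 * ∑ ν, covDeriv η U₀ ν (fun y => adR (B y μ) (B y ν)) x) := by
  rw [pdiv_brk0, ← Finset.add_sum_erase Finset.univ _ (Finset.mem_univ μ)]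
  simp only [adR_self, covDeriv_zero, zero_add]

end Algebra

/-! ## §3 The estimates: **(1.51)** (`48(d − 1)`), `|D*_ν[B_μ, B_ν]| ≤ 8|B||∇B|`, **(1.53)** (`32(d − 1)`) -/
section Bounds

variable {𝔸 : Type*} [NormedRing 𝔸] [NormOneClass 𝔸] [NormedAlgebra ℂ 𝔸]

/-- «taking into account the identity (D*_μA)(x) = −R(…)(D_μA)(x − ηe_μ)»: `|(D*_νF)(x)| = |(D_νF)(x − e_ν)|` for a
`U1`-valued bond variable. [cite: Balaban1985RegularSpaces, p.85 (line after (1.52))] -/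
theorem norm_covDeriv_eq {η : ℝ} {V : Site d → Fin d → 𝔸ˣ} {ν : Fin d} {x : Site d} (hV : V (x - e ν) ν ∈ U1 𝔸)
    (F : Site d → 𝔸) : ‖covDeriv η V ν F x‖ = ‖covDerivFwd η V ν F (x - e ν)‖ := by
  rw [covDeriv_eq_neg_conjR_covDerivFwd, norm_neg, norm_conjR ((U1 𝔸).inv_mem hV)]

omit [NormedAlgebra ℂ 𝔸] in
/-- `|Σᵢxᵢ| ≤ 4a` for `|B_b| ≤ a` and `U1`-valued `U₀`. [cite: Balaban1985RegularSpaces, (1.47) p.84] -/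
theorem norm_lin_le {U₀ : Site d → Fin d → 𝔸ˣ} (h₀ : ∀ y κ, U₀ y κ ∈ U1 𝔸) {B : Site d → Fin d → 𝔸} {a : ℝ}
    (hB : ∀ y κ, ‖B y κ‖ ≤ a) (μ ν : Fin d) (x : Site d) : ‖lin U₀ B μ ν x‖ ≤ 4 * a := by
  unfold lin X1 X2 X3 X4
  calc ‖B x μ + conjR (U₀ x μ) (B (x + e μ) ν) + conjR (U₀ x ν) (-B (x + e ν) μ) + -B x ν‖
      ≤ ‖B x μ‖ + ‖conjR (U₀ x μ) (B (x + e μ) ν)‖ + ‖conjR (U₀ x ν) (-B (x + e ν) μ)‖ + ‖-B x ν‖ :=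
        (norm_add_le _ _).trans (add_le_add norm_add₃_le le_rfl)
    _ ≤ a + a + a + a := by
        gcongr
        · exact hB x μ
        · exact (norm_conjR_le (h₀ x μ) _).trans (hB _ _)
        · exact (norm_conjR_le (h₀ x ν) _).trans ((norm_neg _).trans_le (hB _ _))
        · exact (norm_neg _).trans_le (hB _ _)
    _ = 4 * a := by ring

omit [NormOneClass 𝔸] in
/-- `|Σᵢxᵢ| = η|(D^η_{U₀}A)(p)| = η|D_μB_ν − D_νB_μ| ≤ 2ηG` for `|∇B| ≤ G`, `η > 0` — «all the terms in V₂, except the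
first term …, have some powers of η». [cite: Balaban1985RegularSpaces, p.85; Balaban1985BackgroundPropagators, (3.4) p.391] -/
theorem norm_lin_le_deriv {η : ℝ} (hη : 0 < η) {U₀ : Site d → Fin d → 𝔸ˣ} {B : Site d → Fin d → 𝔸} {G : ℝ}
    (hG : ∀ (y : Site d) (κ τ : Fin d), ‖covDerivFwd η U₀ κ (fun z => B z τ) y‖ ≤ G) (μ ν : Fin d) (x : Site d) :
    ‖lin U₀ B μ ν x‖ ≤ 2 * η * G := by
  rw [lin_eq_smul_plaqCovDeriv hη.ne', plaqCovDeriv_eq_covDerivFwd, norm_smul, Real.norm_of_nonneg hη.le]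
  calc η * ‖covDerivFwd η U₀ μ (fun y => B y ν) x - covDerivFwd η U₀ ν (fun y => B y μ) x‖ ≤ η * (G + G) :=
        mul_le_mul_of_nonneg_left ((norm_sub_le _ _).trans (add_le_add (hG _ _ _) (hG _ _ _))) hη.le
    _ = 2 * η * G := by ring

/-- `|η(D_κB_τ)(y)| = |R(U₀(y, y + e_κ))B_τ(y + e_κ) − B_τ(y)| ≤ 2a`. [cite: Balaban1985RegularSpaces, (1.1) p.76] -/
theorem norm_eta_smul_covDerivFwd_le {η : ℝ} (hη : η ≠ 0) {U₀ : Site d → Fin d → 𝔸ˣ} (h₀ : ∀ y κ, U₀ y κ ∈ U1 𝔸)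
    {B : Site d → Fin d → 𝔸} {a : ℝ} (hB : ∀ y κ, ‖B y κ‖ ≤ a) (y : Site d) (κ τ : Fin d) :
    ‖η • covDerivFwd η U₀ κ (fun z => B z τ) y‖ ≤ 2 * a := by
  rw [eta_smul_covDerivFwd hη]
  calc _ ≤ ‖conjR (U₀ y κ) (B (y + e κ) τ)‖ + ‖B y τ‖ := norm_sub_le _ _
    _ ≤ a + a := add_le_add ((norm_conjR_le (h₀ y κ) _).trans (hB _ _)) (hB _ _)
    _ = 2 * a := by ring

/-- `|η(D*_νB_τ)(x)| = |R(U₀(x, x − e_ν))B_τ(x − e_ν) − B_τ(x)| ≤ 2a`. [cite: Balaban1985RegularSpaces, (1.1) p.76] -/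
theorem norm_eta_smul_covDeriv_le {η : ℝ} (hη : η ≠ 0) {U₀ : Site d → Fin d → 𝔸ˣ} (h₀ : ∀ y κ, U₀ y κ ∈ U1 𝔸)
    {B : Site d → Fin d → 𝔸} {a : ℝ} (hB : ∀ y κ, ‖B y κ‖ ≤ a) (x : Site d) (ν τ : Fin d) :
    ‖η • covDeriv η U₀ ν (fun z => B z τ) x‖ ≤ 2 * a := by
  rw [eta_smul_covDeriv hη]
  calc _ ≤ ‖conjR (U₀ (x - e ν) ν)⁻¹ (B (x - e ν) τ)‖ + ‖B x τ‖ := norm_sub_le _ _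
    _ ≤ a + a := add_le_add ((norm_conjR_le ((U1 𝔸).inv_mem (h₀ _ _)) _).trans (hB _ _)) (hB _ _)
    _ = 2 * a := by ring

/-- THE REST OF `V₂` PER PLAQUETTE: `|V₂(U₀, B, ∂p_{μν}(x)) − 2[B_μ(x), B_ν(x)]| ≤ 24η·a·G` for `|B| ≤ a`, `|∇B| ≤ G`,
`η > 0` — `(Σxᵢ)²` contributes `4a·2ηG`, the five `η`-terms of (1.50) contribute `(4 + 4 + 2 + 2 + 4)ηaG` (the
`η²`-term via `|η(D_μB_ν)(x)| ≤ 2a`). [cite: Balaban1985RegularSpaces, (1.50)-(1.51) p.85] -/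
theorem norm_V2_sub_brk0_le {η : ℝ} (hη : 0 < η) {U₀ : Site d → Fin d → 𝔸ˣ} (h₀ : ∀ y κ, U₀ y κ ∈ U1 𝔸)
    {B : Site d → Fin d → 𝔸} {a G : ℝ} (hB : ∀ y κ, ‖B y κ‖ ≤ a)
    (hG : ∀ (y : Site d) (κ τ : Fin d), ‖covDerivFwd η U₀ κ (fun z => B z τ) y‖ ≤ G) (μ ν : Fin d) (x : Site d) :
    ‖V2 U₀ B μ ν x - brk0 B μ ν x‖ ≤ 24 * η * a * G := by
  rw [V2_eq_sq_add_brk, eq150 hη.ne', brk0_apply]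
  set P' := covDerivFwd η U₀ μ (fun y => B y ν) x with hP'def
  set Q' := covDerivFwd η U₀ ν (fun y => B y μ) x with hQ'def
  have ha0 : 0 ≤ a := (norm_nonneg _).trans (hB x μ)
  have hG0 : 0 ≤ G := (norm_nonneg _).trans (hG x μ ν)
  have ha := hB x μ
  have hb := hB x ν
  have hP : ‖P'‖ ≤ G := hG x μ ν
  have hQ : ‖Q'‖ ≤ G := hG x ν μ
  have hηP : ‖η • P'‖ ≤ 2 * a := norm_eta_smul_covDerivFwd_le hη.ne' h₀ hB x μ ν
  have hsn : ∀ Z : 𝔸, ‖η • Z‖ = η * ‖Z‖ := fun Z => by rw [norm_smul, Real.norm_of_nonneg hη.le]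
  have t1 : ‖lin U₀ B μ ν x * lin U₀ B μ ν x‖ ≤ 4 * a * (2 * η * G) :=
    (norm_mul_le _ _).trans
      (mul_le_mul (norm_lin_le h₀ hB μ ν x) (norm_lin_le_deriv hη hG μ ν x) (norm_nonneg _) (by positivity))
  have t2 : ‖2 * (η • adR (B x μ) P')‖ ≤ 2 * (η * (2 * a * G)) := by
    refine (norm_two_mul_le _).trans (mul_le_mul_of_nonneg_left ?_ zero_le_two)
    rw [hsn]
    exact mul_le_mul_of_nonneg_left (norm_adR_le_of_le ha hP) hη.le
  have t3 : ‖2 * (η • adR Q' (B x ν))‖ ≤ 2 * (η * (2 * G * a)) := by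
    refine (norm_two_mul_le _).trans (mul_le_mul_of_nonneg_left ?_ zero_le_two)
    rw [hsn]
    exact mul_le_mul_of_nonneg_left (norm_adR_le_of_le hQ hb) hη.le
  have t4 : ‖η • adR (B x μ) Q'‖ ≤ η * (2 * a * G) := by
    rw [hsn]
    exact mul_le_mul_of_nonneg_left (norm_adR_le_of_le ha hQ) hη.le
  have t5 : ‖η • adR P' (B x ν)‖ ≤ η * (2 * G * a) := by
    rw [hsn]
    exact mul_le_mul_of_nonneg_left (norm_adR_le_of_le hP hb) hη.le
  have t6 : ‖η ^ 2 • adR P' Q'‖ ≤ η * (2 * (2 * a) * G) := by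
    rw [sq, ← smul_smul, ← adR_smul_left_real η P' Q', hsn]
    exact mul_le_mul_of_nonneg_left (norm_adR_le_of_le hηP hQ) hη.le
  have heq : lin U₀ B μ ν x * lin U₀ B μ ν x +
      (2 * adR (B x μ) (B x ν) + 2 * (η • adR (B x μ) P') + 2 * (η • adR Q' (B x ν)) - η • adR (B x μ) Q'
        - η • adR P' (B x ν) - η ^ 2 • adR P' Q') - 2 * adR (B x μ) (B x ν) =
      lin U₀ B μ ν x * lin U₀ B μ ν x + 2 * (η • adR (B x μ) P') + 2 * (η • adR Q' (B x ν))
        - η • adR (B x μ) Q' - η • adR P' (B x ν) - η ^ 2 • adR P' Q' := by abel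
  rw [heq]
  refine (norm_six_le _ _ _ _ _ _).trans ?_
  nlinarith [t1, t2, t3, t4, t5, t6]

/-- **(1.51)** (sharp form): for `U1`-valued `U₀`, `|B| ≤ a`, `|∇B| ≤ G` on all bonds and `η > 0`,
`|D^{η*}_{U₀}V₂(U₀, B)_μ(x) − D^{η*}_{U₀}(2[B_μ, B_ν])_μ(x)| ≤ 48(d − 1)·a·G` — the `η⁻¹` of `D^{η*}` («we use these
factors to cancel η⁻¹»: `|D*_νG(x)| ≤ η⁻¹(|G(x − e_ν)| + |G(x)|)`) against `24ηaG` per plaquette, `d − 1` directions;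
with `pdiv_brk0` the subtracted term is `−2Σ_{ν≠μ}D*_ν[B_μ, B_ν]`. [cite: Balaban1985RegularSpaces, (1.51) p.85] -/
theorem eq151 {η : ℝ} (hη : 0 < η) {U₀ : Site d → Fin d → 𝔸ˣ} (h₀ : ∀ y κ, U₀ y κ ∈ U1 𝔸)
    {B : Site d → Fin d → 𝔸} {a G : ℝ} (hB : ∀ y κ, ‖B y κ‖ ≤ a)
    (hG : ∀ (y : Site d) (κ τ : Fin d), ‖covDerivFwd η U₀ κ (fun z => B z τ) y‖ ≤ G) (μ : Fin d) (x : Site d) :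
    ‖pdiv η U₀ (V2 U₀ B) μ x - pdiv η U₀ (brk0 B) μ x‖ ≤ 48 * ((d : ℝ) - 1) * a * G := by
  have hsplit : V2 U₀ B = (V2 U₀ B - brk0 B) + brk0 B := (sub_add_cancel _ _).symm
  rw [hsplit, pdiv_add, add_sub_cancel_right]
  have hR : ∀ (κ τ : Fin d) (y : Site d), ‖(V2 U₀ B - brk0 B) κ τ y‖ ≤ 24 * η * a * G := fun κ τ y => by
    simp only [Pi.sub_apply]
    exact norm_V2_sub_brk0_le hη h₀ hB hG κ τ y
  have h1 : η⁻¹ * η = 1 := inv_mul_cancel₀ hη.ne'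
  unfold pdiv
  calc _ ≤ ((d : ℝ) - 1) * (η⁻¹ * (24 * η * a * G + 24 * η * a * G)) := by
        refine norm_sub_sums_le (fun ν _ => ?_) (fun ν _ => ?_)
        · exact (norm_covDeriv_le hη (h₀ _ _) _).trans
            (mul_le_mul_of_nonneg_left (add_le_add (hR _ _ _) (hR _ _ _)) (inv_nonneg.mpr hη.le))
        · exact (norm_covDeriv_le hη (h₀ _ _) _).trans
            (mul_le_mul_of_nonneg_left (add_le_add (hR _ _ _) (hR _ _ _)) (inv_nonneg.mpr hη.le))
    _ = 48 * ((d : ℝ) - 1) * a * G * (η⁻¹ * η) := by ring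
    _ = 48 * ((d : ℝ) - 1) * a * G := by rw [h1, mul_one]

/-- **(1.52) ⇒** `|(D*_ν[B_μ, B_ν])(x)| ≤ 8·a·G` (`η|[D*B_μ, D*B_ν]| = |[ηD*B_μ, D*B_ν]| ≤ 2·2a·G`, `|[D*B_μ, B_ν]|,
|[B_μ, D*B_ν]| ≤ 2aG`, with `|D*_νF(x)| = |D_νF(x − e_ν)| ≤ G` by the transport identity).
[cite: Balaban1985RegularSpaces, (1.52)-(1.53) p.85] -/
theorem norm_covDeriv_adR_le {η : ℝ} (hη : 0 < η) {U₀ : Site d → Fin d → 𝔸ˣ} (h₀ : ∀ y κ, U₀ y κ ∈ U1 𝔸)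
    {B : Site d → Fin d → 𝔸} {a G : ℝ} (hB : ∀ y κ, ‖B y κ‖ ≤ a)
    (hG : ∀ (y : Site d) (κ τ : Fin d), ‖covDerivFwd η U₀ κ (fun z => B z τ) y‖ ≤ G) (μ ν : Fin d) (x : Site d) :
    ‖covDeriv η U₀ ν (fun y => adR (B y μ) (B y ν)) x‖ ≤ 8 * a * G := by
  rw [eq152 hη.ne' U₀ (fun y => B y μ) (fun y => B y ν) ν x, ← adR_smul_left_real]
  have hDF : ‖covDeriv η U₀ ν (fun y => B y μ) x‖ ≤ G := by
    rw [norm_covDeriv_eq (h₀ _ _)]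
    exact hG _ _ _
  have hDH : ‖covDeriv η U₀ ν (fun y => B y ν) x‖ ≤ G := by
    rw [norm_covDeriv_eq (h₀ _ _)]
    exact hG _ _ _
  have hηDF : ‖η • covDeriv η U₀ ν (fun y => B y μ) x‖ ≤ 2 * a := norm_eta_smul_covDeriv_le hη.ne' h₀ hB x ν μ
  calc _ ≤ ‖adR (η • covDeriv η U₀ ν (fun y => B y μ) x) (covDeriv η U₀ ν (fun y => B y ν) x)‖ +
        ‖adR (covDeriv η U₀ ν (fun y => B y μ) x) (B x ν)‖ + ‖adR (B x μ) (covDeriv η U₀ ν (fun y => B y ν) x)‖ :=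
        norm_add₃_le
    _ ≤ 2 * (2 * a) * G + 2 * G * a + 2 * a * G :=
        add_le_add (add_le_add (norm_adR_le_of_le hηDF hDH) (norm_adR_le_of_le hDF (hB x ν)))
          (norm_adR_le_of_le (hB x μ) hDH)
    _ = 8 * a * G := by ring

/-- `|D^{η*}_{U₀}(2[B_μ, B_ν])_μ(x)| = |2Σ_{ν≠μ}D*_ν[B_μ, B_ν](x)| ≤ 16(d − 1)·a·G`. [cite: Balaban1985RegularSpaces, (1.51)-(1.53) p.85] -/
theorem norm_pdiv_brk0_le {η : ℝ} (hη : 0 < η) {U₀ : Site d → Fin d → 𝔸ˣ} (h₀ : ∀ y κ, U₀ y κ ∈ U1 𝔸)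
    {B : Site d → Fin d → 𝔸} {a G : ℝ} (hB : ∀ y κ, ‖B y κ‖ ≤ a)
    (hG : ∀ (y : Site d) (κ τ : Fin d), ‖covDerivFwd η U₀ κ (fun z => B z τ) y‖ ≤ G) (μ : Fin d) (x : Site d) :
    ‖pdiv η U₀ (brk0 B) μ x‖ ≤ 16 * ((d : ℝ) - 1) * a * G := by
  rw [pdiv_brk0, norm_neg]
  refine (norm_two_mul_le _).trans ?_
  have hs : ‖∑ ν ∈ Finset.univ.erase μ, covDeriv η U₀ ν (fun y => adR (B y μ) (B y ν)) x‖ ≤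
      ((d : ℝ) - 1) * (8 * a * G) := by
    refine (norm_sum_le_of_le _ fun ν _ => norm_covDeriv_adR_le hη h₀ hB hG μ ν x).trans ?_
    rw [Finset.sum_const, nsmul_eq_mul, Finset.card_erase_of_mem (Finset.mem_univ μ), Finset.card_univ,
      Fintype.card_fin, Nat.cast_pred (Fin.pos μ)]
  linarith

/-- `|D^{η*}_{U₀}V₂(U₀, B)_μ(x)| ≤ 64(d − 1)·a·G` (`16 + 48`). [cite: Balaban1985RegularSpaces, (1.53) p.85] -/
theorem eq153 {η : ℝ} (hη : 0 < η) {U₀ : Site d → Fin d → 𝔸ˣ} (h₀ : ∀ y κ, U₀ y κ ∈ U1 𝔸)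
    {B : Site d → Fin d → 𝔸} {a G : ℝ} (hB : ∀ y κ, ‖B y κ‖ ≤ a)
    (hG : ∀ (y : Site d) (κ τ : Fin d), ‖covDerivFwd η U₀ κ (fun z => B z τ) y‖ ≤ G) (μ : Fin d) (x : Site d) :
    ‖pdiv η U₀ (V2 U₀ B) μ x‖ ≤ 64 * ((d : ℝ) - 1) * a * G := by
  have h1 := eq151 hη h₀ hB hG μ x
  have h2 := norm_pdiv_brk0_le hη h₀ hB hG μ x
  calc ‖pdiv η U₀ (V2 U₀ B) μ x‖
      = ‖(pdiv η U₀ (V2 U₀ B) μ x - pdiv η U₀ (brk0 B) μ x) + pdiv η U₀ (brk0 B) μ x‖ := by rw [sub_add_cancel]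
    _ ≤ ‖pdiv η U₀ (V2 U₀ B) μ x - pdiv η U₀ (brk0 B) μ x‖ + ‖pdiv η U₀ (brk0 B) μ x‖ := norm_add_le _ _
    _ ≤ 48 * ((d : ℝ) - 1) * a * G + 16 * ((d : ℝ) - 1) * a * G := add_le_add h1 h2
    _ = 64 * ((d : ℝ) - 1) * a * G := by ring

/-- `|D^{η*}_{U₀}(quad)_μ(x)| ≤ 32(d − 1)·a·G` (`quad = ½V₂`; at `B = iηA` this is `½η²|D^{η*}_{U₀}V₂(U₀, A)|` with
`a = η|A|`, `G = η|∇A|`). [cite: Balaban1985RegularSpaces, (1.53) p.85] -/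
theorem eq153_quad {η : ℝ} (hη : 0 < η) {U₀ : Site d → Fin d → 𝔸ˣ} (h₀ : ∀ y κ, U₀ y κ ∈ U1 𝔸)
    {B : Site d → Fin d → 𝔸} {a G : ℝ} (hB : ∀ y κ, ‖B y κ‖ ≤ a)
    (hG : ∀ (y : Site d) (κ τ : Fin d), ‖covDerivFwd η U₀ κ (fun z => B z τ) y‖ ≤ G) (μ : Fin d) (x : Site d) :
    ‖pdiv η U₀ (quad U₀ B) μ x‖ ≤ 32 * ((d : ℝ) - 1) * a * G := by
  rw [quad_eq_half_V2, pdiv_smul, norm_smul, norm_inv, Complex.norm_two]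
  have h := eq153 hη h₀ hB hG μ x
  linarith

/-! ## §4 Print's letters for (1.51) and (1.53): `B := A`, `|A| ≤ α` (`α = α₂(Lʲη)⁻¹`), `|∇^η_{U₀}A| ≤ G` -/

/-- **(1.51) WITH PRINT'S `48d`**: for `U1`-valued `U₀`, `|A| ≤ α` and `|∇^η_{U₀}A| ≤ G` on all bonds, `η > 0`:
`|D^{η*}_{U₀}V₂(U₀, A)_μ(x) − (−2Σ_{ν=1}^{d}(D*_ν[A_μ, A_ν])(x))| ≤ 48d|A||∇^η_{U₀}A|` (indeed `48(d − 1)αG`).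
[cite: Balaban1985RegularSpaces, (1.51) p.85] -/
theorem eq151_printed {η : ℝ} (hη : 0 < η) {U₀ : Site d → Fin d → 𝔸ˣ} (h₀ : ∀ y κ, U₀ y κ ∈ U1 𝔸)
    {A : Site d → Fin d → 𝔸} {α G : ℝ} (hA : ∀ y κ, ‖A y κ‖ ≤ α)
    (hG : ∀ (y : Site d) (κ τ : Fin d), ‖covDerivFwd η U₀ κ (fun z => A z τ) y‖ ≤ G) (μ : Fin d) (x : Site d) :
    ‖pdiv η U₀ (V2 U₀ A) μ x - -(2 * ∑ ν, covDeriv η U₀ ν (fun y => adR (A y μ) (A y ν)) x)‖ ≤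
      48 * d * α * G := by
  rw [← pdiv_brk0_univ]
  refine (eq151 hη h₀ hA hG μ x).trans ?_
  have hα : 0 ≤ α := (norm_nonneg _).trans (hA x μ)
  have hG0 : 0 ≤ G := (norm_nonneg _).trans (hG x μ μ)
  have : 0 ≤ α * G := mul_nonneg hα hG0
  nlinarith

/-- **(1.53) WITH PRINT'S `32d`**: `|½η²D^{η*}_{U₀}V₂(U₀, A)_μ(x)| ≤ 32d|A||∇^η_{U₀}A|η²` for `|A| ≤ α`, `|∇^η_{U₀}A| ≤ G`
(indeed `32(d − 1)αGη²`); with `α = α₂(Lʲη)⁻¹` this reads `O₁(32dα₂(Lʲη)⁻¹|∇^η_{U₀}A|η²)`.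
[cite: Balaban1985RegularSpaces, (1.53) p.85] -/
theorem eq153_printed {η : ℝ} (hη : 0 < η) {U₀ : Site d → Fin d → 𝔸ˣ} (h₀ : ∀ y κ, U₀ y κ ∈ U1 𝔸)
    {A : Site d → Fin d → 𝔸} {α G : ℝ} (hA : ∀ y κ, ‖A y κ‖ ≤ α)
    (hG : ∀ (y : Site d) (κ τ : Fin d), ‖covDerivFwd η U₀ κ (fun z => A z τ) y‖ ≤ G) (μ : Fin d) (x : Site d) :
    ‖((η : ℂ) ^ 2 / 2) • pdiv η U₀ (V2 U₀ A) μ x‖ ≤ 32 * d * α * G * η ^ 2 := by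
  have hc : ((η : ℂ) ^ 2 / 2) = ((η ^ 2 / 2 : ℝ) : ℂ) := by push_cast; ring
  rw [hc, Complex.coe_smul, norm_smul, Real.norm_of_nonneg (by positivity)]
  have h := eq153 hη h₀ hA hG μ x
  have hα : 0 ≤ α := (norm_nonneg _).trans (hA x μ)
  have hG0 : 0 ≤ G := (norm_nonneg _).trans (hG x μ μ)
  have hd1 : (1 : ℝ) ≤ d := Nat.one_le_cast.mpr (Fin.pos μ)
  have h2 : 0 ≤ η ^ 2 / 2 := by positivity
  calc η ^ 2 / 2 * ‖pdiv η U₀ (V2 U₀ A) μ x‖ ≤ η ^ 2 / 2 * (64 * ((d : ℝ) - 1) * α * G) :=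
        mul_le_mul_of_nonneg_left h h2
    _ = 32 * ((d : ℝ) - 1) * α * G * η ^ 2 := by ring
    _ ≤ 32 * d * α * G * η ^ 2 := by
        have : 0 ≤ α * G * η ^ 2 := by positivity
        nlinarith

end Bounds

/-! ## §5 **(1.54)**: gathering (1.44), (1.46), (1.48), (1.53) and the bound on the main term of (1.46) -/
section Gathering

variable {𝔸 : Type*} [NormedRing 𝔸] [NormOneClass 𝔸] [NormedAlgebra ℂ 𝔸] [CompleteSpace 𝔸]

omit [CompleteSpace 𝔸] in
/-- THE MAIN TERM OF (1.46) IS SMALL: `|Σ_{ν≠μ}η⁻¹R(U₀(x, x − e_ν)) ad_{b_ν}(Σᵢxᵢ)(p_{μν}(x − e_ν))| ≤ 4(d − 1)·a·G`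
(`|ad_b Y| ≤ 2a|Y|`, `|Σxᵢ| ≤ 2ηG`; print: `η²·2α₂(Lʲη)⁻¹·2|∇^η_{U₀}A|·d`, the `4d` inside `36d = 32d + 4d`).
[cite: Balaban1985RegularSpaces, (1.46), (1.54) pp.84-85] -/
theorem norm_main146_le {η : ℝ} (hη : 0 < η) {U₀ : Site d → Fin d → 𝔸ˣ} (h₀ : ∀ y κ, U₀ y κ ∈ U1 𝔸)
    {B : Site d → Fin d → 𝔸} {a G : ℝ} (hB : ∀ y κ, ‖B y κ‖ ≤ a)
    (hG : ∀ (y : Site d) (κ τ : Fin d), ‖covDerivFwd η U₀ κ (fun z => B z τ) y‖ ≤ G) (μ : Fin d) (x : Site d) :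
    ‖main146 η U₀ B μ x‖ ≤ 4 * ((d : ℝ) - 1) * a * G := by
  unfold main146
  have h1 : η⁻¹ * η = 1 := inv_mul_cancel₀ hη.ne'
  have key : ∀ ν ∈ Finset.univ.erase μ,
      ‖η⁻¹ • conjR (U₀ (x - e ν) ν)⁻¹ (adR (B (x - e ν) ν) (lin U₀ B μ ν (x - e ν)))‖ ≤ 4 * a * G := by
    intro ν _
    rw [norm_smul, Real.norm_of_nonneg (inv_nonneg.mpr hη.le)]
    calc η⁻¹ * ‖conjR (U₀ (x - e ν) ν)⁻¹ (adR (B (x - e ν) ν) (lin U₀ B μ ν (x - e ν)))‖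
        ≤ η⁻¹ * (2 * a * (2 * η * G)) :=
          mul_le_mul_of_nonneg_left ((norm_conjR_le ((U1 𝔸).inv_mem (h₀ _ _)) _).trans
            (norm_adR_le_of_le (hB _ _) (norm_lin_le_deriv hη hG μ ν _))) (inv_nonneg.mpr hη.le)
      _ = 4 * a * G * (η⁻¹ * η) := by ring
      _ = 4 * a * G := by rw [h1, mul_one]
  refine (norm_sum_le_of_le _ key).trans ?_
  rw [Finset.sum_const, nsmul_eq_mul, Finset.card_erase_of_mem (Finset.mem_univ μ), Finset.card_univ,
    Fintype.card_fin, Nat.cast_pred (Fin.pos μ)]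
  exact le_of_eq (by ring)

omit [NormOneClass 𝔸] in
/-- `|e^{B_b} − 1| ≤ e^{a} − 1` for `|B_b| ≤ a`: the datum `u` of `eq154` may always be taken `e^{a} − 1`.
[folklore] -/
theorem norm_expCfg_sub_one_le {B : Site d → Fin d → 𝔸} {a : ℝ} (hB : ∀ y κ, ‖B y κ‖ ≤ a) (y : Site d)
    (κ : Fin d) : ‖(expCfg B y κ : 𝔸) - 1‖ ≤ Real.exp a - 1 :=
  (norm_exp_sub_one_le_of_norm_le (hB y κ)).1

/-- **(1.54)** (sharp form, general exponent field).  For `U1`-valued `U₀` and `U₁ = e^{B}` `U1`-valued, with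
`|B| ≤ a`, `|∇B| ≤ G` (forward covariant gradient w.r.t. `U₀`), `|U₁ − 1| ≤ u` on all bonds, `|U₀(∂p) − 1| ≤ p` on all
plaquettes, `η > 0`, at every bond `⟨x, x + e_μ⟩`:
`|D^{η*}_{U₁U₀}∂(U₁U₀)_μ(x) − D^{η*}_{U₀}∂U₀,_μ(x) − D^{η*}_{U₀}(Σᵢxᵢ)_μ(x)|
   ≤ 36(d − 1)aG + (d − 1)η⁻¹Φ(a) + 2(d − 1)η⁻¹ρ₃(4a) + 10(d − 1)η⁻¹up`
— «Gathering together the equalities and the estimates obtained until now»: (1.44) `eq144` + (1.46) `eq146` + (1.48)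
`eq148` + (1.53) `eq153_quad` + `norm_main146_le`. [cite: Balaban1985RegularSpaces, (1.54) p.85] -/
theorem eq154 {η : ℝ} (hη : 0 < η) {U₀ : Site d → Fin d → 𝔸ˣ} (h₀ : ∀ y κ, U₀ y κ ∈ U1 𝔸)
    {B : Site d → Fin d → 𝔸} (h₁ : ∀ y κ, expCfg B y κ ∈ U1 𝔸) {a G u p : ℝ} (hB : ∀ y κ, ‖B y κ‖ ≤ a)
    (hG : ∀ (y : Site d) (κ τ : Fin d), ‖covDerivFwd η U₀ κ (fun z => B z τ) y‖ ≤ G)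
    (hu : ∀ y κ, ‖(expCfg B y κ : 𝔸) - 1‖ ≤ u)
    (hp : ∀ (y : Site d) (κ ν : Fin d), κ ≠ ν → ‖plaqF U₀ κ ν y - 1‖ ≤ p) (μ : Fin d) (x : Site d) :
    ‖covDiv η (mulCfg (expCfg B) U₀) μ x - covDiv η U₀ μ x - pdiv η U₀ (lin U₀ B) μ x‖ ≤
      36 * ((d : ℝ) - 1) * a * G + ((d : ℝ) - 1) * (η⁻¹ * phi146 a) +
        2 * ((d : ℝ) - 1) * η⁻¹ * expRem3 (4 * a) + 10 * ((d : ℝ) - 1) * η⁻¹ * u * p := by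
  set U₁ := expCfg B
  set T0 := covDiv η (mulCfg U₁ U₀) μ x
  set T1 := covDiv η U₀ μ x
  set W := pdiv η (mulCfg U₁ U₀) (covPlaqF U₀ U₁) μ x
  set Y := pdiv η U₀ (covPlaqF U₀ U₁ - 1) μ x
  set M := main146 η U₀ B μ x
  set Lq := pdiv η U₀ (lin U₀ B) μ x
  set Qd := pdiv η U₀ (quad U₀ B) μ x
  have e144 : ‖T0 - T1 - W‖ ≤ 10 * ((d : ℝ) - 1) * η⁻¹ * u * p := eq144 hη h₀ h₁ hu hp μ x
  have e146 : ‖W - Y - M‖ ≤ ((d : ℝ) - 1) * (η⁻¹ * phi146 a) := eq146 hη h₀ hB μ x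
  have e148 : ‖Y - Lq - Qd‖ ≤ 2 * ((d : ℝ) - 1) * η⁻¹ * expRem3 (4 * a) := eq148 hη h₀ hB μ x
  have e153 : ‖Qd‖ ≤ 32 * ((d : ℝ) - 1) * a * G := eq153_quad hη h₀ hB hG μ x
  have eM : ‖M‖ ≤ 4 * ((d : ℝ) - 1) * a * G := norm_main146_le hη h₀ hB hG μ x
  have heq : T0 - T1 - Lq = (T0 - T1 - W) + (W - Y - M) + (Y - Lq - Qd) + Qd + M := by abel
  rw [heq]
  have n1 := norm_add_le ((T0 - T1 - W) + (W - Y - M) + (Y - Lq - Qd) + Qd) M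
  have n2 := norm_add_le ((T0 - T1 - W) + (W - Y - M) + (Y - Lq - Qd)) Qd
  have n3 : ‖(T0 - T1 - W) + (W - Y - M) + (Y - Lq - Qd)‖ ≤ ‖T0 - T1 - W‖ + ‖W - Y - M‖ + ‖Y - Lq - Qd‖ :=
    norm_add₃_le
  linarith

/-- **(1.54) WITH THE PRINTED CONSTANTS `36d`, `50d`, `10d`.**  For `U1`-valued `U₀`, `U₁ = e^{iηA}` `U1`-valued with
`|U₁ − 1| ≤ α₂(Lʲη)⁻¹η` (print's (1.41) for Hermitian `A`), `|A| ≤ α₂(Lʲη)⁻¹` and `|∇^η_{U₀}A| ≤ G` on all bonds,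
`|U₀(∂p) − 1| ≤ α₀η²(Lʲη)⁻²` on all plaquettes, `α₀, α₂ ≥ 0`, `η > 0`, and the smallness
`16α₂(Lʲη)⁻¹η ≤ 1 ∧ 5α₂(Lʲη)⁻¹η(d − 1) ≤ 4` (ours; e.g. every `d ≤ 13`), at every bond:
`|D^{η*}_{U₁U₀}∂(U₁U₀) − D^{η*}_{U₀}∂U₀ − iη²D^{η*}_{U₀}D^η_{U₀}A|
   ≤ 36dα₂(Lʲη)⁻¹|∇^η_{U₀}A|η² + 50dα₂³(Lʲη)⁻³η² + 10dα₀α₂(Lʲη)⁻³η²`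
(`eq144_printed` + `eq146_printed` + `eq148_printed` + `eq153` + `norm_main146_le`; `28 + 4³/3 ≤ 50`, `32 + 4 = 36`).
[cite: Balaban1985RegularSpaces, (1.54) p.85] -/
theorem eq154_printed {η : ℝ} (hη : 0 < η) {U₀ : Site d → Fin d → 𝔸ˣ} (h₀ : ∀ y κ, U₀ y κ ∈ U1 𝔸)
    {A : Site d → Fin d → 𝔸} (h₁ : ∀ y κ, expCfg (iEta η A) y κ ∈ U1 𝔸) {L j : ℕ} {α₀ α₂ G : ℝ}
    (hα₀ : 0 ≤ α₀) (hα₂ : 0 ≤ α₂) (hA : ∀ y κ, ‖A y κ‖ ≤ α₂ * ((L : ℝ) ^ j * η)⁻¹)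
    (hG : ∀ (y : Site d) (κ τ : Fin d), ‖covDerivFwd η U₀ κ (fun z => A z τ) y‖ ≤ G)
    (hu : ∀ y κ, ‖(expCfg (iEta η A) y κ : 𝔸) - 1‖ ≤ α₂ * ((L : ℝ) ^ j * η)⁻¹ * η)
    (hp : ∀ (y : Site d) (κ ν : Fin d), κ ≠ ν → ‖plaqF U₀ κ ν y - 1‖ ≤ α₀ * η ^ 2 * (((L : ℝ) ^ j * η)⁻¹) ^ 2)
    (hsmall : 16 * (α₂ * ((L : ℝ) ^ j * η)⁻¹ * η) ≤ 1)
    (hd : 5 * (α₂ * ((L : ℝ) ^ j * η)⁻¹ * η) * ((d : ℝ) - 1) ≤ 4) (μ : Fin d) (x : Site d) :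
    ‖covDiv η (mulCfg (expCfg (iEta η A)) U₀) μ x - covDiv η U₀ μ x -
        ((Complex.I : ℂ) * η ^ 2) • pdiv η U₀ (plaqCovDeriv η U₀ A) μ x‖ ≤
      36 * d * (α₂ * ((L : ℝ) ^ j * η)⁻¹) * G * η ^ 2 + 50 * d * α₂ ^ 3 * (((L : ℝ) ^ j * η)⁻¹) ^ 3 * η ^ 2 +
        10 * d * α₀ * α₂ * (((L : ℝ) ^ j * η)⁻¹) ^ 3 * η ^ 2 := by
  set r : ℝ := ((L : ℝ) ^ j * η)⁻¹
  set U₁ := expCfg (iEta η A)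
  have hr : 0 ≤ r := inv_nonneg.mpr (by positivity)
  have hG0 : 0 ≤ G := (norm_nonneg _).trans (hG x μ μ)
  have hd1 : (1 : ℝ) ≤ d := Nat.one_le_cast.mpr (Fin.pos μ)
  have h4 : 4 * (α₂ * r * η) ≤ 1 := by linarith [hsmall, show 0 ≤ α₂ * r * η by positivity]
  -- the exponent field `B = iηA`: `|B| ≤ ηα₂r`, `|∇B| ≤ ηG`
  have hB : ∀ y κ, ‖iEta η A y κ‖ ≤ η * (α₂ * r) := fun y κ =>
    (norm_iEta_le hη.le hA y κ).trans_eq (by ring)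
  have hGB : ∀ (y : Site d) (κ τ : Fin d), ‖covDerivFwd η U₀ κ (fun z => iEta η A z τ) y‖ ≤ η * G := by
    intro y κ τ
    have hf : (fun z => iEta η A z τ) = ((Complex.I : ℂ) * η) • fun z => A z τ := by
      funext z
      simp only [iEta, Pi.smul_apply]
    rw [hf, covDerivFwd_smul, norm_I_eta_smul hη.le]
    exact mul_le_mul_of_nonneg_left (hG y κ τ) hη.le
  -- the five pieces
  set T0 := covDiv η (mulCfg U₁ U₀) μ x
  set T1 := covDiv η U₀ μ x
  set W := pdiv η (mulCfg U₁ U₀) (covPlaqF U₀ U₁) μ x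
  set Y := pdiv η U₀ (covPlaqF U₀ U₁ - 1) μ x
  set M := ((η : ℂ) ^ 2) • ∑ ν ∈ Finset.univ.erase μ,
    conjR (U₀ (x - e ν) ν)⁻¹ (adR (-A (x - e ν) ν) (plaqCovDeriv η U₀ A μ ν (x - e ν)))
  set P := ((Complex.I : ℂ) * η ^ 2) • pdiv η U₀ (plaqCovDeriv η U₀ A) μ x
  set V := ((η : ℂ) ^ 2 / 2) • pdiv η U₀ (V2 U₀ A) μ x
  have e144 : ‖T0 - T1 - W‖ ≤ 10 * d * α₀ * α₂ * r ^ 3 * η ^ 2 := eq144_printed hη h₀ h₁ hα₀ hα₂ hu hp μ x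
  have e146 : ‖W - Y - M‖ ≤ 28 * d * α₂ ^ 3 * r ^ 3 * η ^ 2 := eq146_printed hη h₀ hα₂ hA hsmall μ x
  have e148 : ‖Y - P + V‖ ≤ 4 ^ 3 / 3 * d * α₂ ^ 3 * r ^ 3 * η ^ 2 := eq148_printed hη h₀ hα₂ hA h4 hd μ x
  have e153 : ‖V‖ ≤ 32 * d * (α₂ * r) * G * η ^ 2 := eq153_printed hη h₀ hA hG μ x
  have eM : ‖M‖ ≤ 4 * d * (α₂ * r) * G * η ^ 2 := by
    have h := norm_main146_le hη h₀ hB hGB μ x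
    rw [main146_printed] at h
    refine h.trans ?_
    have : 0 ≤ α₂ * r * G * η ^ 2 := by positivity
    nlinarith
  have heq : T0 - T1 - P = (T0 - T1 - W) + (W - Y - M) + (Y - P + V) - V + M := by abel
  rw [heq]
  have n1 := norm_add_le ((T0 - T1 - W) + (W - Y - M) + (Y - P + V) - V) M
  have n2 := norm_sub_le ((T0 - T1 - W) + (W - Y - M) + (Y - P + V)) V
  have n3 : ‖(T0 - T1 - W) + (W - Y - M) + (Y - P + V)‖ ≤ ‖T0 - T1 - W‖ + ‖W - Y - M‖ + ‖Y - P + V‖ :=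
    norm_add₃_le
  have hpos : 0 ≤ d * α₂ ^ 3 * r ^ 3 * η ^ 2 := by positivity
  nlinarith

end Gathering

#print axioms eq150
#print axioms eq152
#print axioms covDeriv_eq_neg_conjR_covDerivFwd
#print axioms eq151
#print axioms eq153
#print axioms eq151_printed
#print axioms eq153_printed
#print axioms eq154
#print axioms eq154_printed

end Literature.MathematicalPhysics.QuantumFieldTheory.Balaban1983to89.B8Eq151V2Divergence

end
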